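import Summits.NavierStokesRegularity.NavierStokesRegularity.Theses.AdaptedFrequency
import Literature.Analysis.FluidPDE.AdaptedBackwardKernel
import Literature.Analysis.FluidPDE.ClassicalSolution
import Literature.Analysis.FluidPDE.DriftHeatGaussianBounds

/-!
# Crux `AdaptedFrequencyConverges` (stmt-NavierStokesRegularity-10493), line
  `cloud-frame-effective-tsai`: tools for STUB `stub_doeblin` (kernel uniqueness by Doeblin)

Helper file (theorems only; lands `--supports stmt-NavierStokesRegularity-10493`) for the
registered stub `stub_doeblin` (uniqueness of the Gaussian-comparable adapted backward kernel of
a Type-I drift, GIVEN Kato `L¹` monotonicity and the block solver). Elementary analysis on `ℝ³`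
used by the one-step Doeblin contraction:

* Gaussian envelopes `|W(τ, x)| ≤ A e^{−‖x‖²/a}`: the centred Gaussian integral
  (`doeblin_integral_gauss`), integrability below an envelope, re-centring of an off-centre
  Gaussian, closure of envelopes under sums/differences (`doeblin_envelope_add/sub`), the
  envelope of a Gaussian-bounded kernel on a closed block (`doeblin_kernel_envelope`);
* the uniform Gaussian tail bound `∫_{‖x−x₀‖ ≥ R√ℓ} K ≤ C₁ (2πC₂)^{3/2} e^{−R²/(2C₂)}` for
  `K ≤ C₁ ℓ^{-3/2} e^{−‖x−x₀‖²/(C₂ℓ)}` (`doeblin_tail_le`) — tightness, uniform in the block;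
* positive parts of the difference of two probability densities (`doeblin_posPart`):
  `(g₁ − g₂)⁺` is continuous, `0 ≤ (g₁ − g₂)⁺ ≤ g₁`, integrable, of mass `½ ∫|g₁ − g₂|`;
* `|a − b| = a + b − 2 min a b` for `a, b ≥ 0`, the volume of the core ball
  `|B̄(x₀, R√ℓ)| = R³ ℓ^{3/2} |B₁|`, and the scale invariance of the minorisation profile
  `kSubLow 3 (C/(√ℓ ν)) (3R√ℓ) (νℓ) = ℓ^{-3/2} kSubLow 3 (C/ν) (3R) ν` (all powers of the block
  length `ℓ` cancel: the Doeblin constant is block-independent).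
-/

noncomputable section

namespace Summit.NavierStokesRegularity.NavierStokesRegularity.Theorems.AdaptedFrequencyConverges.CloudFrameEffectiveTsai

open scoped Topology Laplacian
open Literature.Analysis.FluidPDE Set Filter MeasureTheory Function Metric Real

/-! ### Gaussian envelopes on `ℝ³` -/

/-- The centred Gaussian integral on `ℝ³`: `∫ e^{−‖x‖²/a} dx = (π a)^{3/2}` (`a > 0`; Mathlib's
`GaussianFourier.integral_rexp_neg_mul_sq_norm`). -/
theorem doeblin_integral_gauss {a : ℝ} (ha : 0 < a) :
    ∫ x : (EuclideanSpace ℝ (Fin 3)), Real.exp (-‖x‖ ^ 2 / a) = (π * a) ^ ((3:ℝ) / 2) := by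
  have h2 : (fun x : EuclideanSpace ℝ (Fin 3) => Real.exp (-‖x‖ ^ 2 / a)) =
      fun x => Real.exp (-a⁻¹ * ‖x‖ ^ 2) := by
    funext x; congr 1; field_simp
  rw [h2, GaussianFourier.integral_rexp_neg_mul_sq_norm (inv_pos.2 ha)]
  simp only [finrank_euclideanSpace_fin, Nat.cast_ofNat]
  rw [div_inv_eq_mul]

/-- The centred Gaussian `e^{−‖x‖²/a}` (`a > 0`) is integrable on `ℝ³`. -/
theorem doeblin_integrable_gauss {a : ℝ} (ha : 0 < a) :
    Integrable fun x : (EuclideanSpace ℝ (Fin 3)) => Real.exp (-‖x‖ ^ 2 / a) := by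
  by_contra h
  have h2 := doeblin_integral_gauss ha
  rw [integral_undef h] at h2
  exact (Real.rpow_pos_of_pos (by positivity) _).ne h2

/-- A continuous function below a Gaussian envelope is integrable. -/
theorem doeblin_integrable_of_envelope {f : EuclideanSpace ℝ (Fin 3) → ℝ} (hf : Continuous f)
    {A a : ℝ} (ha : 0 < a) (h : ∀ x, |f x| ≤ A * Real.exp (-‖x‖ ^ 2 / a)) : Integrable f :=
  Integrable.mono' ((doeblin_integrable_gauss ha).const_mul A) hf.aestronglyMeasurable
    (Eventually.of_forall fun x => by rw [Real.norm_eq_abs]; exact h x)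

/-- Widening a centred Gaussian: `e^{−‖x‖²/a} ≤ e^{−‖x‖²/a'}` for `0 < a ≤ a'`. -/
theorem doeblin_gauss_mono {a a' : ℝ} (ha : 0 < a) (haa' : a ≤ a') (x : EuclideanSpace ℝ (Fin 3)) :
    Real.exp (-‖x‖ ^ 2 / a) ≤ Real.exp (-‖x‖ ^ 2 / a') := by
  refine Real.exp_le_exp.2 ?_
  rw [neg_div, neg_div, neg_le_neg_iff]
  exact div_le_div_of_nonneg_left (sq_nonneg _) ha haa'

/-- Re-centring an off-centre Gaussian: `e^{−‖x−x₀‖²/c} ≤ e^{‖x₀‖²/c} e^{−‖x‖²/(2c)}` (`c > 0`;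
from `‖x‖² ≤ 2‖x − x₀‖² + 2‖x₀‖²`). -/
theorem doeblin_gauss_recenter {c : ℝ} (hc : 0 < c) (x x₀ : EuclideanSpace ℝ (Fin 3)) :
    Real.exp (-(‖x - x₀‖ ^ 2) / (c)) ≤
      Real.exp (‖x₀‖ ^ 2 / c) * Real.exp (-‖x‖ ^ 2 / (2 * c)) := by
  rw [← Real.exp_add]
  refine Real.exp_le_exp.2 ?_
  have h1 : ‖x‖ ≤ ‖x - x₀‖ + ‖x₀‖ := norm_le_norm_sub_add x x₀
  have h2 : ‖x‖ ^ 2 ≤ 2 * ‖x - x₀‖ ^ 2 + 2 * ‖x₀‖ ^ 2 := by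
    nlinarith [norm_nonneg x, norm_nonneg (x - x₀), norm_nonneg x₀,
      sq_nonneg (‖x - x₀‖ - ‖x₀‖)]
  rw [div_add_div _ _ hc.ne' (by positivity), div_le_div_iff₀ hc (by positivity)]
  have h3 : 0 ≤ c * c * (2 * ‖x - x₀‖ ^ 2 + 2 * ‖x₀‖ ^ 2 - ‖x‖ ^ 2) :=
    mul_nonneg (mul_self_nonneg c) (by linarith)
  nlinarith [h3]

/-- Gaussian envelopes (on a set of times) are closed under addition. -/
theorem doeblin_envelope_add {I : Set ℝ} {W₁ W₂ : ℝ → (EuclideanSpace ℝ (Fin 3)) → ℝ}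
    (h₁ : ∃ A a : ℝ, 0 < a ∧ ∀ τ ∈ I, ∀ x, |W₁ τ x| ≤ A * Real.exp (-‖x‖ ^ 2 / a))
    (h₂ : ∃ A a : ℝ, 0 < a ∧ ∀ τ ∈ I, ∀ x, |W₂ τ x| ≤ A * Real.exp (-‖x‖ ^ 2 / a)) :
    ∃ A a : ℝ, 0 < a ∧ ∀ τ ∈ I, ∀ x, |W₁ τ x + W₂ τ x| ≤ A * Real.exp (-‖x‖ ^ 2 / a) := by
  obtain ⟨A₁, a₁, ha₁, h₁⟩ := h₁
  obtain ⟨A₂, a₂, ha₂, h₂⟩ := h₂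
  refine ⟨|A₁| + |A₂|, max a₁ a₂, lt_max_of_lt_left ha₁, fun τ hτ x => ?_⟩
  have e₁ := doeblin_gauss_mono ha₁ (le_max_left a₁ a₂) x
  have e₂ := doeblin_gauss_mono ha₂ (le_max_right a₁ a₂) x
  have b₁ : |W₁ τ x| ≤ |A₁| * Real.exp (-‖x‖ ^ 2 / max a₁ a₂) :=
    (h₁ τ hτ x).trans ((mul_le_mul_of_nonneg_right (le_abs_self A₁) (Real.exp_pos _).le).trans
      (mul_le_mul_of_nonneg_left e₁ (abs_nonneg _)))
  have b₂ : |W₂ τ x| ≤ |A₂| * Real.exp (-‖x‖ ^ 2 / max a₁ a₂) :=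
    (h₂ τ hτ x).trans ((mul_le_mul_of_nonneg_right (le_abs_self A₂) (Real.exp_pos _).le).trans
      (mul_le_mul_of_nonneg_left e₂ (abs_nonneg _)))
  calc |W₁ τ x + W₂ τ x| ≤ |W₁ τ x| + |W₂ τ x| := abs_add_le _ _
    _ ≤ _ := by rw [add_mul]; exact add_le_add b₁ b₂

/-- Gaussian envelopes are closed under negation. -/
theorem doeblin_envelope_neg {I : Set ℝ} {W : ℝ → (EuclideanSpace ℝ (Fin 3)) → ℝ}
    (h : ∃ A a : ℝ, 0 < a ∧ ∀ τ ∈ I, ∀ x, |W τ x| ≤ A * Real.exp (-‖x‖ ^ 2 / a)) :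
    ∃ A a : ℝ, 0 < a ∧ ∀ τ ∈ I, ∀ x, |(-W τ x)| ≤ A * Real.exp (-‖x‖ ^ 2 / a) := by
  obtain ⟨A, a, ha, h⟩ := h
  exact ⟨A, a, ha, fun τ hτ x => by rw [abs_neg]; exact h τ hτ x⟩

/-- Gaussian envelopes are closed under subtraction. -/
theorem doeblin_envelope_sub {I : Set ℝ} {W₁ W₂ : ℝ → (EuclideanSpace ℝ (Fin 3)) → ℝ}
    (h₁ : ∃ A a : ℝ, 0 < a ∧ ∀ τ ∈ I, ∀ x, |W₁ τ x| ≤ A * Real.exp (-‖x‖ ^ 2 / a))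
    (h₂ : ∃ A a : ℝ, 0 < a ∧ ∀ τ ∈ I, ∀ x, |W₂ τ x| ≤ A * Real.exp (-‖x‖ ^ 2 / a)) :
    ∃ A a : ℝ, 0 < a ∧ ∀ τ ∈ I, ∀ x, |W₁ τ x - W₂ τ x| ≤ A * Real.exp (-‖x‖ ^ 2 / a) := by
  obtain ⟨A, a, ha, h⟩ := doeblin_envelope_add h₁ (doeblin_envelope_neg h₂)
  exact ⟨A, a, ha, fun τ hτ x => by rw [sub_eq_add_neg]; exact h τ hτ x⟩

/-- Gaussian envelopes restrict to smaller sets of times. -/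
theorem doeblin_envelope_mono {I I' : Set ℝ} (hI : I' ⊆ I) {W : ℝ → (EuclideanSpace ℝ (Fin 3)) → ℝ}
    (h : ∃ A a : ℝ, 0 < a ∧ ∀ τ ∈ I, ∀ x, |W τ x| ≤ A * Real.exp (-‖x‖ ^ 2 / a)) :
    ∃ A a : ℝ, 0 < a ∧ ∀ τ ∈ I', ∀ x, |W τ x| ≤ A * Real.exp (-‖x‖ ^ 2 / a) := by
  obtain ⟨A, a, ha, h⟩ := h
  exact ⟨A, a, ha, fun τ hτ x => h τ (hI hτ) x⟩

/-- **Envelope of a Gaussian-bounded kernel on a closed block.** If `0 ≤ K(t, x) ≤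
C₁ (T−t)^{-3/2} e^{−‖x−x₀‖²/(C₂(T−t))}` on `S` and `[σ, σ₁] ⊆ S`, `σ₁ < T`, then `K` has a
centred Gaussian envelope on `[σ, σ₁]` (worst amplitude at `σ₁`, worst width at `σ`,
re-centred at the origin). -/
theorem doeblin_kernel_envelope {K : ℝ → EuclideanSpace ℝ (Fin 3) → ℝ} {S : Set ℝ}
    {x₀ : EuclideanSpace ℝ (Fin 3)} {T σ σ₁ C₁ C₂ : ℝ} (hC₁ : 0 ≤ C₁) (hC₂ : 0 < C₂) (hσ : σ ≤ σ₁)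
    (hσ₁ : σ₁ < T) (hI : Icc σ σ₁ ⊆ S) (hK0 : ∀ t ∈ S, ∀ x, 0 ≤ K t x)
    (hup : ∀ t ∈ S, ∀ x,
      K t x ≤ C₁ * (T - t) ^ (-(3:ℝ) / 2) * Real.exp (-(‖x - x₀‖ ^ 2) / (C₂ * (T - t)))) :
    ∃ A a : ℝ, 0 < a ∧ ∀ τ ∈ Icc σ σ₁, ∀ x, |K τ x| ≤ A * Real.exp (-‖x‖ ^ 2 / a) := by
  refine ⟨C₁ * (T - σ₁) ^ (-(3:ℝ) / 2) * Real.exp (‖x₀‖ ^ 2 / (C₂ * (T - σ))),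
    2 * (C₂ * (T - σ)), by nlinarith [hC₂, sub_pos.2 (hσ.trans_lt hσ₁)], fun τ hτ x => ?_⟩
  have hTτ : 0 < T - τ := by linarith [hτ.2]
  have hTσ : 0 < T - σ := by linarith [hτ.1, hτ.2]
  rw [abs_of_nonneg (hK0 τ (hI hτ) x)]
  refine (hup τ (hI hτ) x).trans ?_
  have h1 : (T - τ) ^ (-(3:ℝ) / 2) ≤ (T - σ₁) ^ (-(3:ℝ) / 2) :=
    Real.rpow_le_rpow_of_nonpos (by linarith [hτ.2]) (by linarith [hτ.2]) (by norm_num)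
  have h2 : Real.exp (-(‖x - x₀‖ ^ 2) / (C₂ * (T - τ))) ≤
      Real.exp (-(‖x - x₀‖ ^ 2) / (C₂ * (T - σ))) := by
    refine Real.exp_le_exp.2 ?_
    rw [neg_div, neg_div, neg_le_neg_iff]
    exact div_le_div_of_nonneg_left (sq_nonneg _) (by positivity)
      (mul_le_mul_of_nonneg_left (by linarith [hτ.1]) hC₂.le)
  have h3 := doeblin_gauss_recenter (c := C₂ * (T - σ)) (by positivity) x x₀
  have hE : 0 ≤ Real.exp (‖x₀‖ ^ 2 / (C₂ * (T - σ))) := (Real.exp_pos _).le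
  calc C₁ * (T - τ) ^ (-(3:ℝ) / 2) * Real.exp (-(‖x - x₀‖ ^ 2) / (C₂ * (T - τ)))
      ≤ C₁ * (T - σ₁) ^ (-(3:ℝ) / 2) * (Real.exp (‖x₀‖ ^ 2 / (C₂ * (T - σ))) *
          Real.exp (-‖x‖ ^ 2 / (2 * (C₂ * (T - σ))))) := by
        gcongr
        exact h2.trans h3
    _ = _ := by ring

/-! ### Uniform Gaussian tails (tightness) -/

/-- **Tail bound.** If `K ≤ C₁ ℓ^{-3/2} e^{−‖x−x₀‖²/(C₂ℓ)}` (`ℓ > 0`) and `K` is integrable, then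
`∫_{‖x−x₀‖ > R√ℓ} K ≤ C₁ (2πC₂)^{3/2} e^{−R²/(2C₂)}`, uniformly in `ℓ` (half of the exponent pays
for `e^{−R²/(2C₂)}`, the other half is a Gaussian of mass `(2πC₂ℓ)^{3/2}`). -/
theorem doeblin_tail_le {K : EuclideanSpace ℝ (Fin 3) → ℝ} {x₀ : EuclideanSpace ℝ (Fin 3)}
    {C₁ C₂ ℓ R : ℝ} (hC₁ : 0 ≤ C₁) (hC₂ : 0 < C₂) (hℓ : 0 < ℓ) (hR : 0 ≤ R) (hKi : Integrable K)
    (hup : ∀ x, K x ≤ C₁ * ℓ ^ (-(3:ℝ) / 2) * Real.exp (-(‖x - x₀‖ ^ 2) / (C₂ * ℓ))) :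
    ∫ x in (closedBall x₀ (R * Real.sqrt ℓ))ᶜ, K x ≤
      C₁ * (2 * π * C₂) ^ ((3:ℝ) / 2) * Real.exp (-R ^ 2 / (2 * C₂)) := by
  obtain ⟨β, hβ⟩ : ∃ β : ℝ, β = 1 / (2 * C₂ * ℓ) := ⟨_, rfl⟩
  have hβ0 : 0 < β := by rw [hβ]; positivity
  obtain ⟨ρ, hρ⟩ : ∃ ρ : ℝ, ρ = R * Real.sqrt ℓ := ⟨_, rfl⟩
  rw [← hρ]
  have hρ0 : 0 ≤ ρ := by rw [hρ]; positivity
  have hρ2 : ρ ^ 2 = R ^ 2 * ℓ := by rw [hρ, mul_pow, Real.sq_sqrt hℓ.le]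
  -- the dominating Gaussian and its integral
  have hgauss : ∫ z : EuclideanSpace ℝ (Fin 3), Real.exp (-β * ‖z - x₀‖ ^ 2) =
      (2 * π * C₂ * ℓ) ^ ((3:ℝ) / 2) := by
    rw [integral_sub_right_eq_self
        (fun v : EuclideanSpace ℝ (Fin 3) => Real.exp (-β * ‖v‖ ^ 2)) x₀,
      GaussianFourier.integral_rexp_neg_mul_sq_norm hβ0, finrank_euclideanSpace_fin, hβ]
    norm_num
    congr 1
    field_simp
  have hgi2 : Integrable fun z : (EuclideanSpace ℝ (Fin 3)) => Real.exp (-β * ‖z - x₀‖ ^ 2) := by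
    by_contra hni
    rw [integral_undef hni] at hgauss
    exact (Real.rpow_pos_of_pos (by positivity) _).ne hgauss
  -- pointwise bound off the ball
  have htail_pt : ∀ z ∉ closedBall x₀ ρ, K z ≤
      C₁ * ℓ ^ (-(3:ℝ) / 2) * Real.exp (-R ^ 2 / (2 * C₂)) * Real.exp (-β * ‖z - x₀‖ ^ 2) := by
    intro z hz
    have hz' : ρ ≤ ‖z - x₀‖ := by
      rw [mem_closedBall, dist_eq_norm, not_le] at hz
      exact hz.le
    have hρsq : ρ ^ 2 ≤ ‖z - x₀‖ ^ 2 := pow_le_pow_left₀ hρ0 hz' 2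
    refine (hup z).trans ?_
    have e1 : -(‖z - x₀‖ ^ 2) / (C₂ * ℓ) = -β * ‖z - x₀‖ ^ 2 + -β * ‖z - x₀‖ ^ 2 := by
      rw [hβ]; field_simp; ring
    have e2 : -β * ‖z - x₀‖ ^ 2 ≤ -R ^ 2 / (2 * C₂) := by
      have : -R ^ 2 / (2 * C₂) = -β * ρ ^ 2 := by rw [hρ2, hβ]; field_simp
      rw [this, neg_mul, neg_mul, neg_le_neg_iff]
      exact mul_le_mul_of_nonneg_left hρsq hβ0.le
    rw [e1, Real.exp_add, ← mul_assoc]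
    gcongr
  have er : ℓ ^ (-(3:ℝ) / 2) * (2 * π * C₂ * ℓ) ^ ((3:ℝ) / 2) = (2 * π * C₂) ^ ((3:ℝ) / 2) := by
    rw [Real.mul_rpow (by positivity) hℓ.le, show (-(3:ℝ) / 2) = -((3:ℝ) / 2) by ring,
      Real.rpow_neg hℓ.le]
    have hne : ℓ ^ ((3:ℝ) / 2) ≠ 0 := (Real.rpow_pos_of_pos hℓ _).ne'
    field_simp
  calc ∫ z in (closedBall x₀ ρ)ᶜ, K z
      ≤ ∫ z in (closedBall x₀ ρ)ᶜ,
          C₁ * ℓ ^ (-(3:ℝ) / 2) * Real.exp (-R ^ 2 / (2 * C₂)) * Real.exp (-β * ‖z - x₀‖ ^ 2) :=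
        setIntegral_mono_on hKi.integrableOn (hgi2.const_mul _).integrableOn
          measurableSet_closedBall.compl fun z hz => htail_pt z hz
    _ ≤ ∫ z, C₁ * ℓ ^ (-(3:ℝ) / 2) * Real.exp (-R ^ 2 / (2 * C₂)) *
          Real.exp (-β * ‖z - x₀‖ ^ 2) :=
        setIntegral_le_integral (hgi2.const_mul _) (Eventually.of_forall fun z => by positivity)
    _ = C₁ * Real.exp (-R ^ 2 / (2 * C₂)) *
          (ℓ ^ (-(3:ℝ) / 2) * (2 * π * C₂ * ℓ) ^ ((3:ℝ) / 2)) := by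
        rw [integral_const_mul, hgauss]; ring
    _ = C₁ * (2 * π * C₂) ^ ((3:ℝ) / 2) * Real.exp (-R ^ 2 / (2 * C₂)) := by rw [er]; ring

/-- The tail bound `C₁ (2πC₂)^{3/2} e^{−R²/(2C₂)}` tends to `0` as `R → ∞`. -/
theorem doeblin_tail_tendsto_zero (C₁ : ℝ) {C₂ : ℝ} (hC₂ : 0 < C₂) :
    Tendsto (fun R : ℝ => C₁ * (2 * π * C₂) ^ ((3:ℝ) / 2) * Real.exp (-R ^ 2 / (2 * C₂)))
      atTop (𝓝 0) := by
  have h2 : Tendsto (fun R : ℝ => Real.exp (-R ^ 2 / (2 * C₂))) atTop (𝓝 0) := by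
    refine Real.tendsto_exp_atBot.comp ?_
    exact (tendsto_neg_atTop_atBot.comp (tendsto_pow_atTop two_ne_zero)).atBot_div_const
      (by positivity)
  have := h2.const_mul (C₁ * (2 * π * C₂) ^ ((3:ℝ) / 2))
  rw [mul_zero] at this
  exact this

/-! ### Positive parts of the difference of two densities -/

/-- Pointwise: `max d 0 − max (−d) 0 = d` and `max d 0 + max (−d) 0 = |d|`. -/
theorem doeblin_max_sub_max_neg (d : ℝ) :
    max d 0 - max (-d) 0 = d ∧ max d 0 + max (-d) 0 = |d| := by
  rcases le_total 0 d with h | h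
  · rw [max_eq_left h, max_eq_right (by linarith), abs_of_nonneg h]; simp
  · rw [max_eq_right h, max_eq_left (by linarith), abs_of_nonpos h]; simp

/-- **Positive part of the difference of two densities.** For continuous integrable `g₁, g₂ ≥ 0`
with `∫ g₁ = ∫ g₂`, the function `p = (g₁ − g₂)⁺` is continuous, `0 ≤ p ≤ g₁`, integrable, and
`∫ p = ½ ∫ |g₁ − g₂|`. (The negative part is the positive part with the roles exchanged.) -/
theorem doeblin_posPart {g₁ g₂ : EuclideanSpace ℝ (Fin 3) → ℝ} (hc₁ : Continuous g₁)
    (hc₂ : Continuous g₂) (hi₁ : Integrable g₁) (hi₂ : Integrable g₂) (h0₁ : ∀ x, 0 ≤ g₁ x)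
    (h0₂ : ∀ x, 0 ≤ g₂ x) (hm : ∫ x, g₁ x = ∫ x, g₂ x) :
    Continuous (fun x => max (g₁ x - g₂ x) 0) ∧ (∀ x, 0 ≤ max (g₁ x - g₂ x) 0) ∧
      (∀ x, max (g₁ x - g₂ x) 0 ≤ g₁ x) ∧ Integrable (fun x => max (g₁ x - g₂ x) 0) ∧
      ∫ x, max (g₁ x - g₂ x) 0 = (∫ x, |g₁ x - g₂ x|) / 2 := by
  have hpi : Integrable (fun x => max (g₁ x - g₂ x) 0) := (hi₁.sub hi₂).pos_part
  refine ⟨(hc₁.sub hc₂).max continuous_const, fun x => le_max_right _ _,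
    fun x => max_le (by linarith [h0₂ x]) (h0₁ x), hpi, ?_⟩
  have hni : Integrable (fun x => max (-(g₁ x - g₂ x)) 0) := by
    have h := (hi₂.sub hi₁).pos_part
    refine h.congr (Eventually.of_forall fun x => ?_)
    simp only [Pi.sub_apply, neg_sub]
  have hsub : ∫ x, (max (g₁ x - g₂ x) 0 - max (-(g₁ x - g₂ x)) 0) = 0 := by
    have h1 : (fun x => max (g₁ x - g₂ x) 0 - max (-(g₁ x - g₂ x)) 0) = fun x => g₁ x - g₂ x :=
      funext fun x => (doeblin_max_sub_max_neg _).1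
    rw [h1, integral_sub hi₁ hi₂, hm, sub_self]
  have hadd : ∫ x, (max (g₁ x - g₂ x) 0 + max (-(g₁ x - g₂ x)) 0) = ∫ x, |g₁ x - g₂ x| :=
    integral_congr_ae (Eventually.of_forall fun x => (doeblin_max_sub_max_neg _).2)
  rw [integral_sub hpi hni] at hsub
  rw [integral_add hpi hni] at hadd
  linarith

/-- For `a, b ≥ 0`: `|a − b| = a + b − 2 min a b`. -/
theorem doeblin_abs_sub_eq (a b : ℝ) : |a - b| = a + b - 2 * min a b := by
  rcases le_total a b with h | h
  · rw [min_eq_left h, abs_of_nonpos (by linarith)]; ring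
  · rw [min_eq_right h, abs_of_nonneg (by linarith)]; ring

/-! ### The core ball and the scale invariance of the minorisation profile -/

/-- Volume of the core ball: `|B̄(x₀, R√ℓ)| = R³ ℓ^{3/2} |B(0, 1)|` on `ℝ³`. -/
theorem doeblin_volume_core (x₀ : EuclideanSpace ℝ (Fin 3)) {R ℓ : ℝ} (hR : 0 ≤ R) (hℓ : 0 < ℓ) :
    volume.real (closedBall x₀ (R * Real.sqrt ℓ)) =
      R ^ 3 * ℓ ^ ((3:ℝ) / 2) * volume.real (ball (0 : EuclideanSpace ℝ (Fin 3)) 1) := by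
  rw [Measure.addHaar_real_closedBall volume x₀ (by positivity), finrank_euclideanSpace_fin,
    mul_pow]
  congr 2
  rw [show ((3:ℝ) / 2) = (1 / 2) * 3 by norm_num, Real.rpow_mul hℓ.le, ← Real.sqrt_eq_rpow,
    Real.rpow_ofNat]

/-- The unit ball of `ℝ³` has positive (finite) volume. -/
theorem doeblin_volume_unitBall_pos : 0 < volume.real (ball (0 : EuclideanSpace ℝ (Fin 3)) 1) := by
  rw [measureReal_def]
  exact ENNReal.toReal_pos (measure_ball_pos volume (0 : EuclideanSpace ℝ (Fin 3)) one_pos).ne'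
    measure_ball_lt_top.ne

/-- **Scale invariance of the minorisation profile.** With drift bound `C/√ℓ` (rescaled by `ν`),
radius `R√ℓ + 2R√ℓ` and age `νℓ`, all powers of the block length `ℓ` in `kSubLow` cancel:
`kSubLow 3 (C/(√ℓ ν)) (3R√ℓ) (νℓ) = ℓ^{-3/2} · kSubLow 3 (C/ν) (3R) ν`. -/
theorem doeblin_kSubLow_scale {ν ℓ : ℝ} (C R : ℝ) (hν : 0 < ν) (hℓ : 0 < ℓ) :
    kSubLow 3 (C / Real.sqrt ℓ / ν) (R * Real.sqrt ℓ + 2 * (R * Real.sqrt ℓ)) (ν * ℓ) =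
      ℓ ^ (-(3:ℝ) / 2) * kSubLow 3 (C / ν) (3 * R) ν := by
  obtain ⟨u, hu, rfl⟩ : ∃ u, 0 < u ∧ ℓ = u ^ 2 :=
    ⟨Real.sqrt ℓ, Real.sqrt_pos.2 hℓ, (Real.sq_sqrt hℓ.le).symm⟩
  have hu0 : u ≠ 0 := hu.ne'
  have hν0 : ν ≠ 0 := hν.ne'
  have e1 : Real.sqrt (u ^ 2) = u := Real.sqrt_sq hu.le
  simp only [e1, kSubLow, dkTilt]
  have e2 : Real.sqrt ((R * u + 2 * (R * u)) ^ 2 + ν * u ^ 2) =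
      u * Real.sqrt ((3 * R) ^ 2 + ν) := by
    rw [show (R * u + 2 * (R * u)) ^ 2 + ν * u ^ 2 = u ^ 2 * ((3 * R) ^ 2 + ν) by ring,
      Real.sqrt_mul (by positivity), e1]
  have e3 : Real.sqrt (ν * u ^ 2) = Real.sqrt ν * u := by rw [Real.sqrt_mul hν.le, e1]
  have e4 : (4 * π * (ν * u ^ 2)) ^ (-(3:ℝ) / 2) =
      (u ^ 2) ^ (-(3:ℝ) / 2) * (4 * π * ν) ^ (-(3:ℝ) / 2) := by
    rw [show 4 * π * (ν * u ^ 2) = (u ^ 2) * (4 * π * ν) by ring,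
      Real.mul_rpow (by positivity) (by positivity)]
  have e5 : -(R * u + 2 * (R * u)) ^ 2 / (4 * (ν * u ^ 2)) = -(3 * R) ^ 2 / (4 * ν) := by
    field_simp; ring
  have e6 : C / u / ν * (u * Real.sqrt ((3 * R) ^ 2 + ν)) +
      2 * (3 + 1) * (C / u / ν) * (Real.sqrt ν * u) + 2 * (C / u / ν) ^ 2 * (ν * u ^ 2) =
      C / ν * Real.sqrt ((3 * R) ^ 2 + ν) + 2 * (3 + 1) * (C / ν) * Real.sqrt ν +
        2 * (C / ν) ^ 2 * ν := by
    field_simp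
  rw [e2, e3, e4, e5, e6]
  ring


/-! ### Registered sub-goal -/

/-- **Registered sub-goal `stub_doeblin_tail`** (tightness, the explicit form of
`doeblin_tail_le`): a density on `ℝ³` below `C₁ ℓ^{-3/2} e^{−‖x−x₀‖²/(C₂ℓ)}` has mass at most
`C₁ (2πC₂)^{3/2} e^{−R²/(2C₂)}` outside the ball `B̄(x₀, R√ℓ)`, uniformly in `ℓ > 0`. -/
theorem stub_doeblin_tail :
    ∀ (K : EuclideanSpace ℝ (Fin 3) → ℝ) (x₀ : EuclideanSpace ℝ (Fin 3)) (C₁ C₂ ℓ R : ℝ), 0 ≤ C₁ → 0 < C₂ → 0 < ℓ → 0 ≤ R → MeasureTheory.Integrable K → (∀ x, K x ≤ C₁ * ℓ ^ (-(3:ℝ) / 2) * Real.exp (-(‖x - x₀‖ ^ 2) / (C₂ * ℓ))) → ∫ x in (Metric.closedBall x₀ (R * Real.sqrt ℓ))ᶜ, K x ≤ C₁ * (2 * Real.pi * C₂) ^ ((3:ℝ) / 2) * Real.exp (-R ^ 2 / (2 * C₂)) :=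
  fun _ _ _ _ _ _ hC₁ hC₂ hℓ hR hKi hup =>
    doeblin_tail_le hC₁ hC₂ hℓ hR hKi hup

end Summit.NavierStokesRegularity.NavierStokesRegularity.Theorems.AdaptedFrequencyConverges.CloudFrameEffectiveTsai

end
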